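import Summits.QuantumFields.YangMills.Theorems.BalabanUVNodesN13UV01LevelZeroOfNormalisationLettersAtRecord13
import Summits.QuantumFields.BalabanUV.T4Continuum.Spine.NE7b.CompactFibreWindowSUNExplicitUpper

/-!
# BalabanUVNodes ∕ N13 — THE LAPLACE UPPER BOUND FOR THE GAUGE-FIXING NORMALISATION `z` OF [I] (0.15) ON `SU(N)`: `log z(g², ε₀) ≤ d(𝔤)·log g + C_N`, `d(𝔤) = N² − 1`
# (companion of the tree's lower bound `B16ZLower.log_zNorm_specialUnitaryGroup_ge`; together `|log z − d(𝔤)·log g| = O(1)`), and (2.50) at level `0` with the Gaussian coefficient `3d(𝔤)`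

Cell `pub-ymgap` (D-0062 Track A ∕ D-0149 width), WIDTH SEAT `pub-ymgap-dag-n13-w1` (gen 6, CLAIM-4), key K1⁹ `StabilityBRunRowsAtRecordR13SepCoPHV` = stmt-QuantumFields-27364
(`route-QuantumFields-BalabanUVNodes` rev 29; `--kind proof --supports … --as helper`; count-neutral).  OWN LINEAGE: g6 CLAIM-1 p638515 `…N13UV01LevelZeroOfNormalisationLettersAtRecord13`
(the four normalisation items; its z-UPPER item at print's `z` had only the trivial `aU = 0`, `z ≤ 1`).  THIS FILE supplies the sharp `aU = d(𝔤)`.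

THE MATHEMATICS ([folklore] Laplace asymptotics on a compact group; nothing of Bałaban's asserted).  `z(α, ε₀) = ∫_{|u−1|<ε₀} exp[−(1∕α)(1 − Re tr u)] du` ([I] (0.15), `du` the Haar
probability of `SU(N)`, `tr` normalised).  (i) For unitary `u`, `1 − Re tr u = ‖u − 1‖²_HS ∕ (2N)` EXACTLY (the tree's `MatrixNorms.nhsNormSq_sub_one_of_mem_unitaryGroup`, [I] (0.14)).
(ii) The tree's EXPLICIT small-ball law for `SU(N)` in the Hilbert–Schmidt norm (`CompactFibreWindowSUNExplicitUpper.haarReal_sball_le_explicit`, cell `pub-balaban-gaps`: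
`Haar{‖u − 1‖_HS ≤ δ} ≤ π·c_N·5^{N²}·vol·δ^{N²−1}` for `δ ≤ 1∕10`) extends to all radii with `D_N := max(π·c_N·5^{N²}·vol b_{N²}(0,1), 10^{N²−1})` (§1).  (iii) SHELLS: on
`{kg ≤ ‖u − 1‖_HS < (k+1)g}` the integrand is `≤ e^{−k²∕(2N)} ≤ e^{−k∕(2N)}` and the shell lies in the ball of radius `(k+1)g`, so pointwise `e^{−(1−Re tr u)∕g²} ≤ Σ_k e^{−k²∕(2N)}·𝟙_{B((k+1)g)}(u)`
and `∫ ≤ Σ_k e^{−k∕(2N)}·D_N·((k+1)g)^{N²−1} = D_N·T_N·g^{N²−1}`, `T_N := Σ_k (k+1)^{N²−1} e^{−k∕(2N)} < ∞` (`lintegral_tsum`; §2).  (iv) `z > 0` (tree's lower bound), hence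
`log z(g², ε₀) ≤ (N² − 1)·log g + log(D_N·T_N)` with `log(D_N·T_N) ≥ 0` (§3).  No `def`: the constants are displayed expressions.

CONTENTS.  §1 `one_sub_reTr_eq_hs_sq`, `haarReal_sball_le_pow`.  §2 `summable_shellSeries`, `one_le_shellSeries`, `exp_neg_sq_le_pow`, ★★ `integral_gaugeFix_SU_le`.  §3 `one_le_DT`, ★★★
`log_zNorm_specialUnitaryGroup_le`, ★★ `zUpper_of_logz_eq_log_zNorm` (the z-UPPER item of p638515 at print's `z` with `aU = d(𝔤)`, `CzU = log(D_N·T_N)`), ★★ `uv_zero_densOfRecord₁₃_of_logz_zNorm_gaussian`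
((2.50) at level `0` at such a witness with `ep = 3d(𝔤)·(log g₀⁻¹ + M∕2) + 4·max(−log σ₀,0) + log(D_N·T_N) + C_E` — the coefficient `3 = 4 − 1` of `B16B10Shape.negE_lower`'s NECESSITY
`E₊ ≥ 3(1 − L⁻⁴)d(𝔤)·log g₀⁻¹ − C₀` now on the SUFFICIENCY side: the level-0 dependence function of (2.50) at print's `z` is `≍ 3d(𝔤)·log g₀⁻¹`).

HONEST FRAMING.  Kernel measure theory on `SU(N)` + real arithmetic; the printed object is only the DEFINITION (0.15) of `z`; nothing of Bałaban's estimates asserted; the Efl volume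
bound stays a displayed hypothesis; LEVEL 0 only; K1⁹ NEITHER proved NOR refuted; N13 NOT discharged; no stub closed; counts unmoved (typed 28∕28 · discharged 5∕27 · A 5∕28); one
finite `𝕋⁴_{L^K}` programme at fixed ε; R4 closes the CONDITIONAL finite-𝕋⁴ rung `BalabanLadder.UV` only — the Yang–Mills mass gap (Clay) is NOT proved by any of this.
No `sorry`, `def`, `instance`, `notation`; standard axioms.
-/

noncomputable section

open MeasureTheory Real
open scoped ENNReal Matrix.Norms.Frobenius BigOperators
open Literature.MathematicalPhysics.QuantumFieldTheory (haarProbability)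
open Literature.MathematicalPhysics.QuantumFieldTheory.UnitaryCayley (haarChartConst frobenius_norm_sq)
open Literature.MathematicalPhysics.QuantumFieldTheory.Balaban1983to89
open Literature.MathematicalPhysics.QuantumFieldTheory.Balaban1983to89.UnitaryModel
open Literature.MathematicalPhysics.QuantumFieldTheory.Balaban1983to89.MatrixNorms
open Summit.QuantumFields.BalabanUV.T4Continuum.NE7b.CompactFibreWindowSUN (measurableSet_sball)
open Summit.QuantumFields.BalabanUV.T4Continuum.NE7b.CompactFibreWindowSUNExplicitUpper (haarReal_sball_le_explicit)
open Literature.MathematicalPhysics.QuantumFieldTheory.Balaban1983to89.T4Continuum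
open Literature.MathematicalPhysics.QuantumFieldTheory.Balaban1983to89.Node00
open Literature.MathematicalPhysics.QuantumFieldTheory.Balaban1983to89.FlowStepRuns (genFlow genSeq genSeq_zero)
open Summit.QuantumFields.YangMills.BalabanUVNodes.N13UV01LevelZeroOfNormalisationLettersAtRecord13
  (zItems_of_logz_eq_log_zNorm uv_zero_densOfRecord₁₃_of_normLetters_of_inInterval_of_invSqFloor dimSU_le_four_mul)

namespace Summit.QuantumFields.YangMills.BalabanUVNodes.N13ZNormLaplaceUpperSU

variable {N : ℕ} [NeZero N]

/-! ## §1 The gauge-fixing exponent is the Hilbert–Schmidt distance squared -/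

/-- **[I] (0.14) AS AN IDENTITY IN THE HILBERT–SCHMIDT NORM**: for `u ∈ SU(N)`, `1 − Re tr u = ‖u − 1‖²_HS ∕ (2N)` (`tr` normalised; the tree's `nhsNormSq_sub_one_of_mem_unitaryGroup` +
`UnitaryCayley.frobenius_norm_sq`). [cite: Balaban1987RG1, (0.14) p.254] -/
theorem one_sub_reTr_eq_hs_sq (u : Matrix.specialUnitaryGroup (Fin N) ℂ) :
    1 - GaugeGroup.reTr u = ‖(u : Matrix (Fin N) (Fin N) ℂ) - 1‖ ^ 2 / (2 * N) := by
  have hU : (u : Matrix (Fin N) (Fin N) ℂ) ∈ Matrix.unitaryGroup (Fin N) ℂ := u.2.1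
  have h := nhsNormSq_sub_one_of_mem_unitaryGroup hU
  rw [nhsNormSq, ← frobenius_norm_sq] at h
  have hN : (0 : ℝ) < N := by exact_mod_cast Nat.pos_of_ne_zero (NeZero.ne N)
  simp only [Fintype.card_fin] at h
  change 1 - nReTr (u : Matrix (Fin N) (Fin N) ℂ) = _
  field_simp at h ⊢
  linarith

/-- **THE SMALL-BALL LAW AT ALL RADII**: `Haar_{SU(N)}{‖u − 1‖_HS ≤ r} ≤ D_N·r^{N²−1}` for every `r > 0`, `D_N = max(π·c_N·5^{N²}·vol b_{N²}(0,1), 10^{N²−1})` — the tree's explicit law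
for `r ≤ 1∕10` (`haarReal_sball_le_explicit`), and `≤ 1 ≤ (10r)^{N²−1}` beyond. [folklore] -/
theorem haarReal_sball_le_pow {r : ℝ} (hr : 0 < r) :
    ((haarProbability (Matrix.specialUnitaryGroup (Fin N) ℂ)) {V : Matrix.specialUnitaryGroup (Fin N) ℂ | ‖(V : Matrix (Fin N) (Fin N) ℂ) - 1‖ ≤ r}).toReal ≤
      max (π * (haarChartConst N : ℝ) * 5 ^ (N * N) * (volume (Metric.closedBall (0 : EuclideanSpace ℝ (Fin N × Fin N)) 1)).toReal) (10 ^ (N * N - 1)) * r ^ (N * N - 1) := by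
  have hNN : 1 ≤ N * N := Nat.one_le_iff_ne_zero.mpr (Nat.mul_ne_zero (NeZero.ne N) (NeZero.ne N))
  by_cases h10 : r ≤ 1 / 10
  · have h := haarReal_sball_le_explicit (N := N) hr h10
    refine h.trans ?_
    have heq : π / r * ((haarChartConst N : ℝ) * ((5 * r) ^ (N * N) * (volume (Metric.closedBall (0 : EuclideanSpace ℝ (Fin N × Fin N)) 1)).toReal))
        = (π * (haarChartConst N : ℝ) * 5 ^ (N * N) * (volume (Metric.closedBall (0 : EuclideanSpace ℝ (Fin N × Fin N)) 1)).toReal) * r ^ (N * N - 1) := by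
      have : (5 * r) ^ (N * N) = 5 ^ (N * N) * (r ^ (N * N - 1) * r) := by
        rw [mul_pow, ← pow_succ, Nat.sub_add_cancel hNN]
      rw [this]; field_simp
    rw [heq]
    exact mul_le_mul_of_nonneg_right (le_max_left _ _) (by positivity)
  · rw [not_le] at h10
    have hprob : ((haarProbability (Matrix.specialUnitaryGroup (Fin N) ℂ)) {V : Matrix.specialUnitaryGroup (Fin N) ℂ | ‖(V : Matrix (Fin N) (Fin N) ℂ) - 1‖ ≤ r}).toReal ≤ 1 := by
      have := prob_le_one (μ := haarProbability (Matrix.specialUnitaryGroup (Fin N) ℂ)) (s := {V : Matrix.specialUnitaryGroup (Fin N) ℂ | ‖(V : Matrix (Fin N) (Fin N) ℂ) - 1‖ ≤ r})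
      exact ENNReal.toReal_le_of_le_ofReal zero_le_one (by simpa using this)
    refine hprob.trans ?_
    have h1 : (1 : ℝ) ≤ (10 : ℝ) ^ (N * N - 1) * r ^ (N * N - 1) := by
      rw [← mul_pow]; exact one_le_pow₀ (by linarith)
    exact h1.trans (mul_le_mul_of_nonneg_right (le_max_right _ _) (by positivity))

/-! ## §2 The shell series `T_N = Σ_k (k+1)^{N²−1} e^{−k∕(2N)}` and the Laplace upper bound `∫ e^{−(1−Re tr u)∕g²} du ≤ D_N·T_N·g^{N²−1}` -/

/-- The shell series `Σ_{k≥0} (k+1)^{N²−1}·(e^{−1∕(2N)})^k` converges (polynomial times geometric). [folklore] -/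
theorem summable_shellSeries : Summable (fun k : ℕ => ((k : ℝ) + 1) ^ (N * N - 1) * Real.exp (-(1 / (2 * (N : ℝ)))) ^ k) := by
  set r : ℝ := Real.exp (-(1 / (2 * (N : ℝ)))) with hr
  have hr0 : 0 < r := Real.exp_pos _
  have hN : (0 : ℝ) < N := by exact_mod_cast Nat.pos_of_ne_zero (NeZero.ne N)
  have hr1 : r < 1 := Real.exp_lt_one_iff.mpr (by rw [neg_lt_zero]; positivity)
  have hs : Summable (fun n : ℕ => ((n : ℝ)) ^ (N * N - 1) * r ^ n) :=
    summable_pow_mul_geometric_of_norm_lt_one (N * N - 1) (by rwa [Real.norm_eq_abs, abs_of_pos hr0])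
  have hs1 : Summable (fun n : ℕ => (((n + 1 : ℕ) : ℝ)) ^ (N * N - 1) * r ^ (n + 1)) := (summable_nat_add_iff 1).mpr hs
  have heq : (fun k : ℕ => ((k : ℝ) + 1) ^ (N * N - 1) * r ^ k) = fun k => r⁻¹ * ((((k + 1 : ℕ) : ℝ)) ^ (N * N - 1) * r ^ (k + 1)) := by
    funext k
    rw [pow_succ]; push_cast; field_simp
  rw [heq]
  exact hs1.mul_left _

/-- The shell series is at least its first term `1`. [folklore] -/
theorem one_le_shellSeries : 1 ≤ ∑' k : ℕ, ((k : ℝ) + 1) ^ (N * N - 1) * Real.exp (-(1 / (2 * (N : ℝ)))) ^ k := by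
  have h := (summable_shellSeries (N := N)).le_tsum 0 (fun k _ => by positivity)
  simpa using h

/-- `e^{−k²∕(2N)} ≤ (e^{−1∕(2N)})^k` for `k ∈ ℕ` (`k ≤ k²`). [folklore] -/
theorem exp_neg_sq_le_pow (k : ℕ) : Real.exp (-((k : ℝ) ^ 2 / (2 * N))) ≤ Real.exp (-(1 / (2 * (N : ℝ)))) ^ k := by
  rw [← Real.exp_nat_mul, Real.exp_le_exp]
  have hN0 : (0 : ℝ) < N := by exact_mod_cast Nat.pos_of_ne_zero (NeZero.ne N)
  have hN : (0 : ℝ) < 2 * N := by linarith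
  have hk : (k : ℝ) ≤ (k : ℝ) ^ 2 := by exact_mod_cast Nat.le_self_pow two_ne_zero k
  have h1 : (k : ℝ) ^ 2 / (2 * N) = (k : ℝ) ^ 2 * (1 / (2 * N)) := by ring
  have h2 : 0 < 1 / (2 * (N : ℝ)) := by positivity
  rw [h1]
  nlinarith

/-- ★ **THE LAPLACE UPPER BOUND ON `SU(N)`** (`g > 0`): `∫_{SU(N)} exp[−(1∕g²)(1 − Re tr u)] du ≤ D_N·T_N·g^{N²−1}` with `D_N = max(π·c_N·5^{N²}·vol b_{N²}(0,1), 10^{N²−1})`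
(the tree's explicit small-ball law `CompactFibreWindowSUNExplicitUpper.haarReal_sball_le_explicit`, extended to all radii) and `T_N` the shell series: `1 − Re tr u = ‖u − 1‖²_HS∕(2N)`
(§1), the integrand on the shell `kg ≤ ‖u − 1‖_HS < (k+1)g` is `≤ e^{−k²∕(2N)} ≤ e^{−k∕(2N)}`, the shell's mass is `≤ D_N((k+1)g)^{N²−1}`; summed via `lintegral_tsum`. [folklore] -/
theorem integral_gaugeFix_SU_le {g : ℝ} (hg : 0 < g) :
    ∫ u, Real.exp (-(1 / g ^ 2) * (1 - GaugeGroup.reTr u)) ∂(haarProbability (Matrix.specialUnitaryGroup (Fin N) ℂ)) ≤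
      max (π * (haarChartConst N : ℝ) * 5 ^ (N * N) * (volume (Metric.closedBall (0 : EuclideanSpace ℝ (Fin N × Fin N)) 1)).toReal) (10 ^ (N * N - 1))
        * (∑' k : ℕ, ((k : ℝ) + 1) ^ (N * N - 1) * Real.exp (-(1 / (2 * (N : ℝ)))) ^ k) * g ^ (N * N - 1) := by
  set μ : Measure (Matrix.specialUnitaryGroup (Fin N) ℂ) := haarProbability (Matrix.specialUnitaryGroup (Fin N) ℂ) with hμ
  set D : ℝ := max (π * (haarChartConst N : ℝ) * 5 ^ (N * N) * (volume (Metric.closedBall (0 : EuclideanSpace ℝ (Fin N × Fin N)) 1)).toReal) (10 ^ (N * N - 1)) with hD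
  set r : ℝ := Real.exp (-(1 / (2 * (N : ℝ)))) with hr
  set T : ℝ := ∑' k : ℕ, ((k : ℝ) + 1) ^ (N * N - 1) * r ^ k with hT
  set m : ℕ := N * N - 1 with hm
  set f : Matrix.specialUnitaryGroup (Fin N) ℂ → ℝ := fun u => Real.exp (-(1 / g ^ 2) * (1 - GaugeGroup.reTr u)) with hf
  set B : ℕ → Set (Matrix.specialUnitaryGroup (Fin N) ℂ) := fun k => {V | ‖(V : Matrix (Fin N) (Fin N) ℂ) - 1‖ ≤ ((k : ℝ) + 1) * g} with hB
  set a : ℕ → ℝ≥0∞ := fun k => ENNReal.ofReal (Real.exp (-((k : ℝ) ^ 2 / (2 * N)))) with ha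
  have hN : (0 : ℝ) < N := by exact_mod_cast Nat.pos_of_ne_zero (NeZero.ne N)
  have hD0 : 0 ≤ D := le_trans (by positivity) (le_max_right _ _)
  have hr0 : 0 ≤ r := (Real.exp_pos _).le
  -- Step A: the pointwise shell bound
  have hpt : ∀ u, ENNReal.ofReal (f u) ≤ ∑' k, (B k).indicator (fun _ => a k) u := by
    intro u
    set x : ℝ := ‖(u : Matrix (Fin N) (Fin N) ℂ) - 1‖ with hx
    have hx0 : 0 ≤ x := norm_nonneg _
    set k₀ : ℕ := ⌊x / g⌋₊ with hk₀
    have hk₀le : (k₀ : ℝ) ≤ x / g := Nat.floor_le (div_nonneg hx0 hg.le)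
    have hk₀lt : x / g < k₀ + 1 := Nat.lt_floor_add_one _
    have hmem : u ∈ B k₀ := by
      show x ≤ ((k₀ : ℝ) + 1) * g
      have := (div_lt_iff₀ hg).mp hk₀lt
      linarith
    have hfu : f u ≤ Real.exp (-((k₀ : ℝ) ^ 2 / (2 * N))) := by
      show Real.exp (-(1 / g ^ 2) * (1 - GaugeGroup.reTr u)) ≤ _
      rw [one_sub_reTr_eq_hs_sq, Real.exp_le_exp]
      have h1 : (k₀ : ℝ) ^ 2 ≤ (x / g) ^ 2 := pow_le_pow_left₀ (Nat.cast_nonneg _) hk₀le 2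
      have h2 : (x / g) ^ 2 = x ^ 2 / g ^ 2 := by rw [div_pow]
      rw [h2] at h1
      have h3 : (k₀ : ℝ) ^ 2 / (2 * N) ≤ x ^ 2 / g ^ 2 / (2 * N) := div_le_div_of_nonneg_right h1 (by linarith)
      have h4 : -(1 / g ^ 2) * (x ^ 2 / (2 * ↑N)) = -(x ^ 2 / g ^ 2 / (2 * N)) := by ring
      rw [h4]
      linarith
    calc ENNReal.ofReal (f u) ≤ a k₀ := ENNReal.ofReal_le_ofReal hfu
      _ = (B k₀).indicator (fun _ => a k₀) u := by rw [Set.indicator_of_mem hmem]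
      _ ≤ ∑' k, (B k).indicator (fun _ => a k) u := ENNReal.le_tsum k₀
  -- Step B: integrate the shell bound
  have hmeasB : ∀ k, MeasurableSet (B k) := fun k => measurableSet_sball _
  have hlin : ∫⁻ u, ENNReal.ofReal (f u) ∂μ ≤ ∑' k, a k * μ (B k) := by
    calc ∫⁻ u, ENNReal.ofReal (f u) ∂μ ≤ ∫⁻ u, ∑' k, (B k).indicator (fun _ => a k) u ∂μ := lintegral_mono hpt
      _ = ∑' k, ∫⁻ u, (B k).indicator (fun _ => a k) u ∂μ :=
          lintegral_tsum fun k => (measurable_const.indicator (hmeasB k)).aemeasurable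
      _ = ∑' k, a k * μ (B k) := by
          congr 1; funext k; rw [lintegral_indicator_const (hmeasB k)]
  -- Step C: each shell term
  have hterm : ∀ k : ℕ, a k * μ (B k) ≤ ENNReal.ofReal (D * g ^ m * (((k : ℝ) + 1) ^ m * r ^ k)) := by
    intro k
    have hμ : μ (B k) = ENNReal.ofReal ((μ (B k)).toReal) := (ENNReal.ofReal_toReal (measure_ne_top μ _)).symm
    have hball := haarReal_sball_le_pow (N := N) (r := ((k : ℝ) + 1) * g) (by positivity)
    have hak : Real.exp (-((k : ℝ) ^ 2 / (2 * N))) ≤ r ^ k := exp_neg_sq_le_pow (N := N) k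
    rw [hμ, show a k = ENNReal.ofReal (Real.exp (-((k : ℝ) ^ 2 / (2 * N)))) from rfl, ← ENNReal.ofReal_mul (Real.exp_nonneg _)]
    apply ENNReal.ofReal_le_ofReal
    calc Real.exp (-((k : ℝ) ^ 2 / (2 * N))) * (μ (B k)).toReal ≤ r ^ k * (D * (((k : ℝ) + 1) * g) ^ (N * N - 1)) :=
          mul_le_mul hak hball ENNReal.toReal_nonneg (pow_nonneg hr0 k)
      _ = D * g ^ m * (((k : ℝ) + 1) ^ m * r ^ k) := by rw [hm, mul_pow]; ring
  -- Step D: sum the shells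
  have hsumm : Summable (fun k : ℕ => D * g ^ m * (((k : ℝ) + 1) ^ m * r ^ k)) := (summable_shellSeries (N := N)).mul_left _
  have hsum : ∑' k, a k * μ (B k) ≤ ENNReal.ofReal (D * T * g ^ m) := by
    calc ∑' k, a k * μ (B k) ≤ ∑' k : ℕ, ENNReal.ofReal (D * g ^ m * (((k : ℝ) + 1) ^ m * r ^ k)) := ENNReal.tsum_le_tsum hterm
      _ = ENNReal.ofReal (∑' k : ℕ, D * g ^ m * (((k : ℝ) + 1) ^ m * r ^ k)) :=
          (ENNReal.ofReal_tsum_of_nonneg (fun k => by positivity) hsumm).symm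
      _ = ENNReal.ofReal (D * T * g ^ m) := by rw [tsum_mul_left, mul_right_comm]
  -- Step E: back to the Bochner integral
  have hf0 : 0 ≤ᵐ[μ] f := Filter.Eventually.of_forall fun u => Real.exp_nonneg _
  have hfm : AEStronglyMeasurable f μ := (B16ZLower.measurable_gaugeFixIntegrand (G := Matrix.specialUnitaryGroup (Fin N) ℂ) (g ^ 2)).aestronglyMeasurable
  rw [integral_eq_lintegral_of_nonneg_ae hf0 hfm]
  exact ENNReal.toReal_le_of_le_ofReal (by positivity) (hlin.trans hsum)

/-! ## §3 The logarithmic form: the z-UPPER item at print's coefficient `d(𝔤) = N² − 1`, and (2.50) at level `0` with the Gaussian coefficient `3d(𝔤)` -/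

/-- `1 ≤ D_N·T_N` (`D_N ≥ 10^{N²−1} ≥ 1`, `T_N ≥ 1`), so the item constant `log(D_N·T_N)` is `≥ 0`. [folklore] -/
theorem one_le_DT : 1 ≤ max (π * (haarChartConst N : ℝ) * 5 ^ (N * N) * (volume (Metric.closedBall (0 : EuclideanSpace ℝ (Fin N × Fin N)) 1)).toReal) (10 ^ (N * N - 1))
        * (∑' k : ℕ, ((k : ℝ) + 1) ^ (N * N - 1) * Real.exp (-(1 / (2 * (N : ℝ)))) ^ k) :=
  one_le_mul_of_one_le_of_one_le (le_trans (one_le_pow₀ (by norm_num)) (le_max_right _ _)) one_le_shellSeries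

/-- ★★ **THE LAPLACE UPPER BOUND FOR THE NORMALISATION `z` OF [I] (0.15) ON `SU(N)`, LOGARITHMIC FORM** (`g > 0`, `ε₀ > 0`):
`log z(g², ε₀) ≤ d(𝔤)·log g + log(D_N·T_N)`, `d(𝔤) = N² − 1` — the companion of the tree's lower bound `B16ZLower.log_zNorm_specialUnitaryGroup_ge` (`≥ d(𝔤)·log g − C_z^{SU}`), so
`|log z(g², ε₀) − d(𝔤)·log g| = O(1)` uniformly in `0 < g ≤ 1`: print's coefficient is pinned two-sidedly.  (`z > 0` by the lower bound at `r = ε₀∕2`.) [cite: Balaban1987RG1, (0.14)–(0.17) pp.254–255] -/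
theorem log_zNorm_specialUnitaryGroup_le {g ε₀ : ℝ} (hg : 0 < g) (hε : 0 < ε₀) :
    Real.log (B16ZLower.zNorm (SU N) (g ^ 2) ε₀) ≤
      ((dimSU N : ℕ) : ℝ) * Real.log g +
        Real.log (max (π * (haarChartConst N : ℝ) * 5 ^ (N * N) * (volume (Metric.closedBall (0 : EuclideanSpace ℝ (Fin N × Fin N)) 1)).toReal) (10 ^ (N * N - 1))
          * (∑' k : ℕ, ((k : ℝ) + 1) ^ (N * N - 1) * Real.exp (-(1 / (2 * (N : ℝ)))) ^ k)) := by
  set DT : ℝ := max (π * (haarChartConst N : ℝ) * 5 ^ (N * N) * (volume (Metric.closedBall (0 : EuclideanSpace ℝ (Fin N × Fin N)) 1)).toReal) (10 ^ (N * N - 1))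
          * (∑' k : ℕ, ((k : ℝ) + 1) ^ (N * N - 1) * Real.exp (-(1 / (2 * (N : ℝ)))) ^ k) with hDT
  have hDT1 : 1 ≤ DT := one_le_DT
  haveI := HaarData.isProb (G := SU N)
  -- z ≤ ∫ f ≤ D·T·g^m
  set f : SU N → ℝ := fun u => Real.exp (-(1 / g ^ 2) * (1 - GaugeGroup.reTr u)) with hf
  have hf0 : ∀ u, 0 ≤ f u := fun u => B16ZLower.gaugeFixIntegrand_nonneg (g ^ 2) u
  have hf1 : ∀ u, f u ≤ 1 := fun u => B16ZLower.gaugeFixIntegrand_le_one (pow_pos hg 2) u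
  have hfi : Integrable f (HaarData.haar : Measure (SU N)) := Integrable.of_bound (B16ZLower.measurable_gaugeFixIntegrand (g ^ 2)).aestronglyMeasurable 1
    (Filter.Eventually.of_forall fun u => by rw [Real.norm_eq_abs, abs_of_nonneg (hf0 u)]; exact hf1 u)
  have hz_le : B16ZLower.zNorm (SU N) (g ^ 2) ε₀ ≤ DT * g ^ (N * N - 1) := by
    unfold B16ZLower.zNorm
    exact (setIntegral_le_integral hfi (Filter.Eventually.of_forall hf0)).trans (integral_gaugeFix_SU_le (N := N) hg)
  have hz_pos : 0 < B16ZLower.zNorm (SU N) (g ^ 2) ε₀ := by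
    have h := B16ZLower.zNorm_specialUnitaryGroup_ge (N := N) (α := g ^ 2) (r := ε₀ / 2) (pow_pos hg 2) (by positivity) (half_lt_self hε)
    exact lt_of_lt_of_le (by positivity) h
  have hm : N * N - 1 = dimSU N := by unfold dimSU; rw [sq]
  calc Real.log (B16ZLower.zNorm (SU N) (g ^ 2) ε₀) ≤ Real.log (DT * g ^ (N * N - 1)) := Real.log_le_log hz_pos hz_le
    _ = ((dimSU N : ℕ) : ℝ) * Real.log g + Real.log DT := by
        rw [Real.log_mul (by positivity) (pow_pos hg _).ne', Real.log_pow, hm]; ring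

variable {F : T4Family}

/-- ★★ **THE z-UPPER ITEM AT PRINT's COEFFICIENT**: if a Stage-13 parameter's letter `logz_j` IS `log z(g_j², ε)` on `SU(N)`, then along any run with positive couplings
`logz_j ≤ d(𝔤)·log g_j + log(D_N·T_N)` for `j < K` — `aU = d(𝔤)` in `…N13UV01LevelZeroOfNormalisationLettersAtRecord13`'s items (there `aU = 0` was the trivial `z ≤ 1`).
[cite: Balaban1987RG1, (0.14)–(0.17) pp.254–255] -/
theorem zUpper_of_logz_eq_log_zNorm (θ : Stage13Params F N) (P : B12.RunParams) {ε : ℝ} (hε : 0 < ε)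
    (hz : ∀ j, j < P.K → θ.logz P j = Real.log (B16ZLower.zNorm (SU N) (gOfRecord₁₃ F N θ P j ^ 2) ε))
    {γ : ℝ} (hI : (genFlow (betaOfRecord₁₃ F N θ) P.g0).InInterval γ P.K) :
    ∀ j, j < P.K → θ.logz P j ≤ ((dimSU N : ℕ) : ℝ) * Real.log (gOfRecord₁₃ F N θ P j) +
        Real.log (max (π * (haarChartConst N : ℝ) * 5 ^ (N * N) * (volume (Metric.closedBall (0 : EuclideanSpace ℝ (Fin N × Fin N)) 1)).toReal) (10 ^ (N * N - 1))
          * (∑' k : ℕ, ((k : ℝ) + 1) ^ (N * N - 1) * Real.exp (-(1 / (2 * (N : ℝ)))) ^ k)) := by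
  intro j hj
  rw [hz j hj]
  exact log_zNorm_specialUnitaryGroup_le (N := N) (hI j hj.le).1 hε

/-- ★★★ **(2.50) AT LEVEL `0` WITH THE GAUSSIAN COEFFICIENT `3d(𝔤)`** at a Stage-13 parameter whose `logz` IS print's `z` on `SU(N)` and whose `|Efl_j| ≤ C_E·|T₁^{(j+1)}|`, along a γ-windowed run
(`γ ≤ 1`) under the coupling floor `g_j⁻² ≤ g₀⁻² + M`: `χβ₀·exp(−g₀⁻²A^η₀ − em·|T₁^{(0)}|) ≤ ρ₀ ≤ exp(ep·|T₁^{(0)}|)` with `em = 4·max(log σ₀,0) + C_z^{SU}(N,ε) + C_E + 12g₀⁻²` and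
`ep = 3d(𝔤)·(log g₀⁻¹ + M∕2) + 4·max(−log σ₀,0) + log(D_N·T_N) + C_E` — the coefficient `3 = 4 (bond variables) − 1 (gauge-fixing `z`)` of `B16B10Shape.negE_lower`'s necessity
`E₊ ≥ 3(1−L⁻⁴)d(𝔤)·log g₀⁻¹ − C₀`, now on the sufficiency side.  `…NormalisationLettersAtRecord13` §4 with `aL = aU = d(𝔤)`.
[cite: Balaban1989LargeFieldII, (0.1) pp.355–356; Balaban1988Convergent, (2.50) p.264, Thm 1 p.262, (1.15) p.249; Balaban1987RG1, (0.15) p.254, (0.20) p.256] -/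
theorem uv_zero_densOfRecord₁₃_of_logz_zNorm_gaussian {γ M ε CE : ℝ} (θ : Stage13Params F N) (P : B12.RunParams) (hγ : γ ≤ 1) (hM : 0 ≤ M) (hε : 0 < ε) (hCE : 0 ≤ CE)
    (hfl : ∀ j, j ≤ P.K → (gOfRecord₁₃ F N θ P j ^ 2)⁻¹ ≤ (P.g0 ^ 2)⁻¹ + M)
    (hI : (genFlow (betaOfRecord₁₃ F N θ) P.g0).InInterval γ P.K)
    (hz : ∀ j, j < P.K → θ.logz P j = Real.log (B16ZLower.zNorm (SU N) (gOfRecord₁₃ F N θ P j ^ 2) ε))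
    (hE : ∀ j, j < P.K → |θ.Efl P j| ≤ CE * sitesCard (F.P P.K) (j + 1))
    (U : GaugeField (F.P P.K) 0 (SU N)) :
    chiβOfRecord₁₃ F N θ P.K (gOfRecord₁₃ F N θ P) 0 U *
          Real.exp (-(1 / (gOfRecord₁₃ F N θ P 0)) ^ 2 * wilsonBGOfRecord F N θ.εbg P 0 U
            - (4 * max θ.ν.logσ₀ 0 + B16ZLower.CzSU N ε + CE + 12 * (1 / gOfRecord₁₃ F N θ P 0) ^ 2) * (Fintype.card (Site (F.P P.K) 0) : ℝ)) ≤ densOfRecord₁₃ F N θ P 0 U ∧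
      densOfRecord₁₃ F N θ P 0 U ≤
        Real.exp ((3 * ((dimSU N : ℕ) : ℝ) * (Real.log (gOfRecord₁₃ F N θ P 0)⁻¹ + M / 2) + 4 * max (-θ.ν.logσ₀) 0 +
            Real.log (max (π * (haarChartConst N : ℝ) * 5 ^ (N * N) * (volume (Metric.closedBall (0 : EuclideanSpace ℝ (Fin N × Fin N)) 1)).toReal) (10 ^ (N * N - 1))
              * (∑' k : ℕ, ((k : ℝ) + 1) ^ (N * N - 1) * Real.exp (-(1 / (2 * (N : ℝ)))) ^ k)) + CE)
          * (Fintype.card (Site (F.P P.K) 0) : ℝ)) := by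
  have hzL := (zItems_of_logz_eq_log_zNorm θ P hε hz hγ hI).1
  have hzU := zUpper_of_logz_eq_log_zNorm θ P hε hz hI
  have h := uv_zero_densOfRecord₁₃_of_normLetters_of_inInterval_of_invSqFloor θ P hγ hM hfl hI dimSU_le_four_mul dimSU_le_four_mul
    (B16ZLower.CzSU_nonneg (N := N) hε) (Real.log_nonneg one_le_DT) hCE hCE hzL hzU
    (fun j hj => by have := hE j hj; have := neg_abs_le (θ.Efl P j); linarith) (fun j hj => (le_abs_self _).trans (hE j hj)) U
  refine ⟨h.1, ?_⟩
  convert h.2 using 3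
  ring

end Summit.QuantumFields.YangMills.BalabanUVNodes.N13ZNormLaplaceUpperSU
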